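import Summits.HodgeConjecture.CorCM.PairwisePartialConjCMHodge
import Literature.NumberTheory.ComplexMultiplication.CMTypeRankForeignQuadraticSlot
import Literature.NumberTheory.ComplexMultiplication.SharedImaginaryQuadraticFamilies
import HarnessLib

/-!
# FOREIGN imaginary quadratic fields: CM elliptic curves `E_j` whose fields do NOT embed in the CM fields `K_b` of
# the other factors — the third menu for the pairwise criterion, the EXACT nondegeneracy criterion for
# `∏_j E_j^{a_j} × ∏_b A_b^{c_b}`, and the Hodge conjecture for these products

COR-CM (cell `pub-hodgecm2`, binder seat `b16` gen 37, count-neutral claim FOREIGN-IQ (F2)); NEW as stated, hence under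
`Summits/`.  Theorems only; no definition, no named fact, no `sorry`.

Moonen–Zarhin [MoonenZarhin1999LowDim, Thm. (0.2)] sort the abelian fourfolds `X ∼ X₁ × X₂`, `X₁` an elliptic curve
with complex multiplication by `k`, `X₂` a simple abelian threefold, by ONE condition: exceptional Hodge classes occur
(case (a)) iff "there exists an embedding `k ↪ End⁰(X₂)`"; otherwise (case (4)) `B•(Xⁿ) = D•(Xⁿ)` for all `n`.  For
`X₂` of CM type with CM field `K`, `End⁰(X₂) = K`, and the condition is `k ↪ K`.  The tree's menus for the pairwise
"no common constituent" criterion (`PairwiseCMFamiliesHodge`: (□) on the big slot; `PairwisePartialConjCMHodge`: a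
partial conjugation, i.e. `k ⊄ L_b`, the GALOIS CLOSURE of `K_b`) both stop short of this: for a non-Galois `K_b` an
imaginary quadratic field may lie in `L_b` but not in `K_b` (for `K_b = F(√−a)` with `[F : ℚ]` odd, `√(−N_{F/ℚ}(a)) ∈ L_b`
always), and then neither (□) nor a partial conjugation need exist.  The literature file
`NumberTheory/ComplexMultiplication/CMTypeRankForeignQuadraticSlot` (this seat) proves the field-theoretic heart of
Moonen–Zarhin's dichotomy: if `[k : ℚ] = 2` and `k` does NOT embed in `K_b`, the stabiliser of `Hom(k, ℂ)` in `Aut(ℂ)`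
acts TRANSITIVELY on `Hom(K_b, ℂ)`, so `ℚ^{Hom(K_b, ℂ)}` has no eigenvector for the quadratic character `χ_k`.  This
file draws the consequences BY NAME (p2's `pairwise_of_eigenvector`, `isNondegenerateFamily_iff_forall_of_pairwise`;
b23's `not_isNondegenerateFamily_of_shared_imaginary_quadratic` for the converse):

* §0 `PairwiseCC.eq_zero_of_eigen_of_isEmpty` — for an imaginary quadratic slot `a` FOREIGN to `K_b`
  (`IsEmpty (K a →+* K b)`) and any `χ` trivial on the stabiliser of `Hom(K_a, ℂ)` and non-trivial at complex
  conjugation, every `χ`-eigenvector on `ℚ^{Hom(K_b, ℂ)}` vanishes; **`pairwise_of_isEmpty`** — the slots `a`, `b` have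
  no common constituent (both orders); `isEmpty_ringHom_of_exists_partialConj`, `isEmpty_ringHom_of_smul_smul` —
  foreignness FOLLOWS from a partial conjugation and from (□): the third menu contains the other two on curve–big pairs.
* §1 **`pairwise_of_menu₃`** (quadratic slots off `B = {i | p i}` pairwise distinguished; EVERY quadratic slot foreign
  to EVERY `K_b`, `b ∈ B`; pairwise partial conjugations inside `B`) ⟹ the pairwise criterion;
  **`isNondegenerateFamily_iff_of_menu₃`** — the family is nondegenerate iff every `Φ_b`, `b ∈ B`, is;
  `cmFamilyRank_add_card_eq_of_menu₃` — `rank Hg(∏) = Σ rank Hg`; and the EXACT criterion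
  **`isNondegenerateFamily_iff_forall_isEmpty`**: under the quadratic-pair and big-pair hypotheses ALONE,
  `IsNondegenerateFamily Φ ↔ (∀ b ∈ B, IsNondegenerate (Φ b)) ∧ ∀ a ∉ B, ∀ b ∈ B, IsEmpty (K a →+* K b)` — a shared
  imaginary quadratic field is the ONLY obstruction (converse: b23's theorem).
* §2 geometry, for realisations `(A_i, ι_i, θ_i)`: `hodgeConjectureFor_prod_of_menu₃`,
  `hodgeClassSpan_prod_eq_divisorClassesSpan_of_menu₃` (`B• = D•` on every `⨁_{j<N} A_{π j}`),
  **`forall_prod_hodgeClassSpan_eq_iff_forall_isEmpty`** (separating families: `B• = D•` on ALL products iff the big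
  types are nondegenerate and no curve field embeds in a `K_b`),
  **`hodgeConjectureFor_prod_curves_simple_of_isEmpty`** — the Hodge conjecture for EVERY
  `E_1^{a_1} × ⋯ × E_r^{a_r} × A_1^{c_1} × ⋯ × A_m^{c_m}` with `E_j` pairwise non-isogenous CM elliptic curves whose
  fields embed in NO `K_b`, `A_b` SIMPLE CM abelian varieties of dimension `≤ 3` whose Galois closures pairwise meet in
  totally real fields — unconditionally; e.g. ONE simple CM threefold `T` with ANY sextic CM field `K` and curves with
  CM by imaginary quadratic fields `k_j ⊄ K` (Moonen–Zarhin (0.2) (4) for `X₁ × X₂`, CM case, all powers and products).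

## References

* [MoonenZarhin1999LowDim] B. Moonen, Yu. Zarhin, *Hodge classes on abelian varieties of low dimension*, Math. Ann.
  315 (1999) 711–733, Thm. (0.2) (a)/(4), Cor. (3.9).
* [Gordon1999HodgeAVSurvey] B. B. Gordon, *A survey of the Hodge conjecture for abelian varieties*, §3 Theorem (Imai,
  Murty) with proof; 7.5–7.7; 10.10.
* [Ribet1980] K. Ribet, *Division fields of abelian varieties with complex multiplication*, §3 (3.7).
* [Shimura1998] G. Shimura, *Abelian Varieties with Complex Multiplication and Modular Functions*, §8.2 Prop. 26.
-/

noncomputable section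

open CategoryTheory CategoryTheory.Limits NumberField NumberField.ComplexEmbedding IntermediateField
open scoped BigOperators

namespace Summit.HodgeConjecture.CorCM

open Literature.NumberTheory.ComplexMultiplication
open Literature.AlgebraicGeometry.Motives (AbelianVariety CMType)
open Literature.AlgebraicGeometry.HodgeTheory
open Literature.AlgebraicGeometry.ComplexMultiplication (IsCMTypeRealisation isSimple_iff_isPrimitive)
open Literature.AlgebraicGeometry.VanGeemen1994 (hodgeClassSpan)
open Literature.AlgebraicGeometry.Pohlmann1968
open Literature.Barriers.HodgeConjecture (divisorClassesSpan)

/-! ## §0 A foreign imaginary quadratic slot has no common constituent with the slot it is foreign to -/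

section Fields

variable {I : Type} {K : I → Type} [∀ i, Field (K i)] [∀ i, NumberField (K i)] [∀ i, IsCMField (K i)]

omit [∀ i, IsCMField (K i)] in
/-- **No `χ`-eigenvector on `ℚ^{Hom(K_b, ℂ)}` for a character of a FOREIGN quadratic slot**: if `[K_a : ℚ] = 2`, `K_a` does
not embed in `K_b`, `χ(τ) = 1` whenever `τ` fixes every embedding of `K_a`, and `χ(ρ) ≠ 1` for complex conjugation `ρ`,
then every `f : Hom(K_b, ℂ) → ℚ` with `f ∘ g = χ(g) f` vanishes (the stabiliser of `Hom(K_a, ℂ)` acts transitively on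
`Hom(K_b, ℂ)`, so `f` is constant). [cite: MoonenZarhin1999LowDim, Thm. (0.2) (4) and Cor. (3.9)] -/
theorem PairwiseCC.eq_zero_of_eigen_of_isEmpty {a b : I} (h2 : Module.finrank ℚ (K a) = 2)
    (he : IsEmpty (K a →+* K b)) (χ : (ℂ ≃+* ℂ) → ℚ) (hχ1 : ∀ τ : ℂ ≃+* ℂ, (∀ u : K a →+* ℂ, τ • u = u) → χ τ = 1)
    (hχρ : χ (starRingAut : ℂ ≃+* ℂ) ≠ 1) {f : (K b →+* ℂ) → ℚ}
    (heig : ∀ g : ℂ ≃+* ℂ, (fun x => f (g • x)) = χ g • f) : f = 0 :=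
  eq_zero_of_eigen_of_transitive χ heig
    (fun x y => by
      obtain ⟨τ, hτu, hτx⟩ := exists_ringEquiv_smul_eq_of_isEmpty h2 he x y
      exact ⟨τ, hχ1 τ hτu, hτx⟩)
    hχρ

/-- **A foreign imaginary quadratic slot has no common constituent with the slot it is foreign to** (both orders): for
`[K_a : ℚ] = 2` and `IsEmpty (K a →+* K b)`, no non-zero `Aut(ℂ)`-stable `P ≤ U(Φ_a)` maps equivariantly and injectively
into `U(Φ_b)`, nor vice versa — `U(Φ_a) = ℚ u` is `χ_a`-isotypic and `ℚ^{Hom(K_b, ℂ)}` has no `χ_a`-eigenvector.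
[cite: MoonenZarhin1999LowDim, Thm. (0.2) (4) and Cor. (3.9)] [cite: Gordon1999HodgeAVSurvey, §3 Theorem (proof)] -/
theorem pairwise_of_isEmpty (Φ : ∀ i, CMType (K i)) {a b : I} (h2 : Module.finrank ℚ (K a) = 2)
    (he : IsEmpty (K a →+* K b)) :
    (∀ P : Submodule ℚ ((K a →+* ℂ) → ℚ), P ≤ antiSpan (ℂ ≃+* ℂ) (Φ a).1 →
      (∀ g : ℂ ≃+* ℂ, ∀ f ∈ P, (fun x => f (g • x)) ∈ P) →
      ∀ T : ((K a →+* ℂ) → ℚ) →ₗ[ℚ] ((K b →+* ℂ) → ℚ),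
        (∀ g : ℂ ≃+* ℂ, ∀ f ∈ P, T (fun x => f (g • x)) = fun y => T f (g • y)) →
        (∀ f ∈ P, T f ∈ antiSpan (ℂ ≃+* ℂ) (Φ b).1) → (∀ f ∈ P, T f = 0 → f = 0) → P = ⊥) ∧
    (∀ P : Submodule ℚ ((K b →+* ℂ) → ℚ), P ≤ antiSpan (ℂ ≃+* ℂ) (Φ b).1 →
      (∀ g : ℂ ≃+* ℂ, ∀ f ∈ P, (fun x => f (g • x)) ∈ P) →
      ∀ T : ((K b →+* ℂ) → ℚ) →ₗ[ℚ] ((K a →+* ℂ) → ℚ),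
        (∀ g : ℂ ≃+* ℂ, ∀ f ∈ P, T (fun x => f (g • x)) = fun y => T f (g • y)) →
        (∀ f ∈ P, T f ∈ antiSpan (ℂ ≃+* ℂ) (Φ a).1) → (∀ f ∈ P, T f = 0 → f = 0) → P = ⊥) := by
  classical
  have hCM : IsCMTypeWith (starRingAut : ℂ ≃+* ℂ) (Φ a).1 := isCMTypeWith_conj (Φ a)
  have hc : Fintype.card (K a →+* ℂ) = 2 := by rw [Embeddings.card, h2]
  have hquad : ∀ f ∈ antiSpan (ℂ ≃+* ℂ) (Φ a).1, ∀ g : ℂ ≃+* ℂ,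
      (fun x => f (g • x)) = TwoSlot.slotSign (ℂ ≃+* ℂ) (fun i => K i →+* ℂ) a g • f := fun f hf g =>
    PairwiseCC.comp_smul_eq_slotSign_smul (Φ := fun i => (Φ i).1) hCM hc hf g
  have hρ : TwoSlot.slotSign (ℂ ≃+* ℂ) (fun i => K i →+* ℂ) a (starRingAut : ℂ ≃+* ℂ) ≠ 1 := by
    rw [TwoSlot.slotSign_of_forall_smul_eq_rho_smul (Φ := fun i => (Φ i).1) hCM hc (g := starRingAut) fun s => rfl]
    norm_num
  have hzero : ∀ f ∈ antiSpan (ℂ ≃+* ℂ) (Φ b).1,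
      (∀ g : ℂ ≃+* ℂ, (fun x => f (g • x)) = TwoSlot.slotSign (ℂ ≃+* ℂ) (fun i => K i →+* ℂ) a g • f) → f = 0 :=
    fun f _ heig => PairwiseCC.eq_zero_of_eigen_of_isEmpty h2 he
      (TwoSlot.slotSign (ℂ ≃+* ℂ) (fun i => K i →+* ℂ) a) (fun τ hτ => TwoSlot.slotSign_of_forall_smul_eq hτ) hρ heig
  exact pairwise_of_eigenvector (G := ℂ ≃+* ℂ) (Φ := fun i => (Φ i).1) (i := a) (j := b)
    (TwoSlot.slotSign (ℂ ≃+* ℂ) (fun i => K i →+* ℂ) a) hquad hzero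

/-- **A partial conjugation forces foreignness**: if some `σ ∈ Aut(ℂ)` is complex conjugation on `Hom(K_a, ℂ)` and the
identity on `Hom(K_b, ℂ)` (`K_a` totally complex), then `K_a` does not embed in `K_b` (an embedding `j` gives
`σ ∘ (s ∘ j) = s ∘ j` and `= \overline{s ∘ j}`). [cite: Gordon1999HodgeAVSurvey, §3 Theorem (proof)] -/
theorem isEmpty_ringHom_of_exists_partialConj {a b : I}
    (hσ : ∃ σ : ℂ ≃+* ℂ, (∀ u : K a →+* ℂ, σ • u = conjugate u) ∧ ∀ s : K b →+* ℂ, σ • s = s) :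
    IsEmpty (K a →+* K b) := by
  obtain ⟨σ, hσa, hσb⟩ := hσ
  refine ⟨fun j => ?_⟩
  obtain ⟨s⟩ : Nonempty (K b →+* ℂ) := inferInstance
  have h1 : σ • (s.comp j) = s.comp j := by
    refine RingHom.ext fun x => ?_
    rw [ringEquiv_smul_apply, RingHom.comp_apply, ← ringEquiv_smul_apply σ s (j x), hσb s]
  have hreal : ComplexEmbedding.IsReal (s.comp j) := by
    rw [ComplexEmbedding.isReal_iff, ← hσa (s.comp j), h1]
  exact IsTotallyComplex.complexEmbedding_not_isReal (s.comp j) hreal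

/-- **(□) forces foreignness**: if `[K_a : ℚ] = 2` and some `τ ∈ Aut(ℂ)` satisfies `τ ∘ τ ∘ s = s̄` for all
`s : K_b → ℂ`, then `K_a` does not embed in `K_b` (`τ²` is the identity on the two embeddings of `K_a`, but conjugation
on `s ∘ j`). [cite: Gordon1999HodgeAVSurvey, §3 Theorem (proof)] -/
theorem isEmpty_ringHom_of_smul_smul (Φ : ∀ i, CMType (K i)) {a b : I} (h2 : Module.finrank ℚ (K a) = 2)
    (hτ : ∃ τ : ℂ ≃+* ℂ, ∀ s : K b →+* ℂ, τ • τ • s = conjugate s) : IsEmpty (K a →+* K b) := by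
  classical
  obtain ⟨τ, hτ⟩ := hτ
  have hCM : IsCMTypeWith (starRingAut : ℂ ≃+* ℂ) (Φ a).1 := isCMTypeWith_conj (Φ a)
  have hc : Fintype.card (K a →+* ℂ) = 2 := by rw [Embeddings.card, h2]
  refine ⟨fun j => ?_⟩
  obtain ⟨s⟩ : Nonempty (K b →+* ℂ) := inferInstance
  -- `τ ∘ τ` is the identity on the two-element slot `Hom(K_a, ℂ)`
  have hsq : ∀ u : K a →+* ℂ, τ • τ • u = u := by
    intro u
    rcases TwoSlot.forall_smul_eq_or_forall_smul_eq_rho_smul (G := ℂ ≃+* ℂ) (E := fun i => K i →+* ℂ)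
      (Φ := fun i => (Φ i).1) (i := a) hCM hc τ with hfix | hrho
    · rw [hfix u, hfix u]
    · rw [hrho u, hCM.comm, hrho u, hCM.invol]
  have h1 : τ • τ • (s.comp j) = (τ • τ • s).comp j := rfl
  have hreal : ComplexEmbedding.IsReal (s.comp j) := by
    rw [ComplexEmbedding.isReal_iff]
    have h := hsq (s.comp j)
    rw [h1, hτ s] at h
    -- `h : (conjugate s).comp j = s.comp j`
    exact h
  exact IsTotallyComplex.complexEmbedding_not_isReal (s.comp j) hreal

/-! ## §1 The third menu and the exact criterion -/

/-- **The third menu.**  The pairwise criterion holds for a family whose slots off `B = {i | p i}` are imaginary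
quadratic and pairwise distinguished by some automorphism of `ℂ`, EVERY quadratic slot being FOREIGN to every `K_b`,
`b ∈ B` (`IsEmpty (K a →+* K b)`), and whose pairs inside `B` carry pairwise partial conjugations.  Contains the
curve–big clauses of the first menu ((□)) and of the second (partial conjugations), both of which imply foreignness.
[cite: MoonenZarhin1999LowDim, Thm. (0.2) (4)] [cite: Gordon1999HodgeAVSurvey, §3 Theorem (proof)] -/
theorem pairwise_of_menu₃ (p : I → Prop) (Φ : ∀ i, CMType (K i))
    (h2 : ∀ j, ¬p j → Module.finrank ℚ (K j) = 2)
    (hχ : ∀ i j, ¬p i → ¬p j → i ≠ j → ∃ g : ℂ ≃+* ℂ,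
      ¬((∀ s : K i →+* ℂ, g • s = s) ↔ ∀ s : K j →+* ℂ, g • s = s))
    (hfor : ∀ a b, ¬p a → p b → IsEmpty (K a →+* K b))
    (hbb : ∀ a b, p a → p b → a ≠ b →
      ∃ σ : ℂ ≃+* ℂ, (∀ s : K a →+* ℂ, σ • s = conjugate s) ∧ ∀ s : K b →+* ℂ, σ • s = s) :
    ∀ i j, i ≠ j → ∀ P : Submodule ℚ ((K i →+* ℂ) → ℚ), P ≤ antiSpan (ℂ ≃+* ℂ) (Φ i).1 →
      (∀ g : ℂ ≃+* ℂ, ∀ f ∈ P, (fun x => f (g • x)) ∈ P) →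
      ∀ T : ((K i →+* ℂ) → ℚ) →ₗ[ℚ] ((K j →+* ℂ) → ℚ),
        (∀ g : ℂ ≃+* ℂ, ∀ f ∈ P, T (fun x => f (g • x)) = fun y => T f (g • y)) →
        (∀ f ∈ P, T f ∈ antiSpan (ℂ ≃+* ℂ) (Φ j).1) → (∀ f ∈ P, T f = 0 → f = 0) → P = ⊥ := by
  classical
  have hCM : ∀ i, IsCMTypeWith (starRingAut : ℂ ≃+* ℂ) (Φ i).1 := fun i => isCMTypeWith_conj (Φ i)
  have hc : ∀ j, ¬p j → Fintype.card (K j →+* ℂ) = 2 := fun j hj => by rw [Embeddings.card, h2 j hj]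
  intro i j hij
  by_cases hi : p i <;> by_cases hj : p j
  · -- two big slots: a pairwise partial conjugation
    obtain ⟨σ, hσa, hσb⟩ := hbb i j hi hj hij
    exact (pairwise_of_partialConj (G := ℂ ≃+* ℂ) (Φ := fun i => (Φ i).1) hCM (i := i) (j := j) (σ := σ)
      (fun s => by rw [hσa s, conj_smul_eq_conjugate]) hσb).1
  · -- `i` big, `j` quadratic and foreign to `K_i`
    exact (pairwise_of_isEmpty Φ (h2 j hj) (hfor j i hj hi)).2
  · -- `i` quadratic and foreign to `K_j`, `j` big
    exact (pairwise_of_isEmpty Φ (h2 i hi) (hfor i j hi hj)).1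
  · -- two quadratic slots with different sign characters
    have hquad : ∀ j, ¬p j → ∀ f ∈ antiSpan (ℂ ≃+* ℂ) (Φ j).1, ∀ g : ℂ ≃+* ℂ,
        (fun x => f (g • x)) = TwoSlot.slotSign (ℂ ≃+* ℂ) (fun i => K i →+* ℂ) j g • f := fun j hj f hf g =>
      PairwiseCC.comp_smul_eq_slotSign_smul (Φ := fun i => (Φ i).1) (hCM j) (hc j hj) hf g
    have hne : ∃ g : ℂ ≃+* ℂ,
        TwoSlot.slotSign (ℂ ≃+* ℂ) (fun i => K i →+* ℂ) i g ≠ TwoSlot.slotSign (ℂ ≃+* ℂ) (fun i => K i →+* ℂ) j g := by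
      obtain ⟨g, hg⟩ := hχ i j hi hj hij
      refine ⟨g, fun heq => hg ?_⟩
      rw [TwoSlot.forall_smul_eq_iff_slotSign_eq_one (G := ℂ ≃+* ℂ) (E := fun i => K i →+* ℂ)
          (Φ := fun i => (Φ i).1) (hCM i) (hc i hi) g,
        TwoSlot.forall_smul_eq_iff_slotSign_eq_one (G := ℂ ≃+* ℂ) (E := fun i => K i →+* ℂ)
          (Φ := fun i => (Φ i).1) (hCM j) (hc j hj) g, heq]
    exact (pairwise_of_eigenvector (G := ℂ ≃+* ℂ) (Φ := fun i => (Φ i).1) (i := i) (j := j)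
      (TwoSlot.slotSign (ℂ ≃+* ℂ) (fun i => K i →+* ℂ) i) (hquad i hi) fun f hf heig =>
        PairwiseCC.eq_zero_of_eigen_of_card_eq_two (Φ := fun i => (Φ i).1) (hCM j) (hc j hj) _ hne hf heig).1

variable [Fintype I] [DecidableEq I] [Nonempty I]

/-- **Nondegeneracy from the third menu**: the family is nondegenerate iff every non-quadratic member is.
[cite: MoonenZarhin1999LowDim, Thm. (0.2) (4)] [cite: Gordon1999HodgeAVSurvey, §3 Theorem and 7.5] -/
theorem isNondegenerateFamily_iff_of_menu₃ (p : I → Prop) (Φ : ∀ i, CMType (K i))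
    (h2 : ∀ j, ¬p j → Module.finrank ℚ (K j) = 2)
    (hχ : ∀ i j, ¬p i → ¬p j → i ≠ j → ∃ g : ℂ ≃+* ℂ,
      ¬((∀ s : K i →+* ℂ, g • s = s) ↔ ∀ s : K j →+* ℂ, g • s = s))
    (hfor : ∀ a b, ¬p a → p b → IsEmpty (K a →+* K b))
    (hbb : ∀ a b, p a → p b → a ≠ b →
      ∃ σ : ℂ ≃+* ℂ, (∀ s : K a →+* ℂ, σ • s = conjugate s) ∧ ∀ s : K b →+* ℂ, σ • s = s) :
    CMAlgebra.IsNondegenerateFamily Φ ↔ ∀ b, p b → IsNondegenerate (Φ b) := by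
  rw [isNondegenerateFamily_iff_forall_of_pairwise Φ (pairwise_of_menu₃ p Φ h2 hχ hfor hbb)]
  refine ⟨fun H b _ => H b, fun H i => ?_⟩
  by_cases hi : p i
  · exact H i hi
  · exact isNondegenerate_of_finrank_eq_two (Φ i) (h2 i hi)

/-- **Rank additivity from the third menu**: `rank((Φ_i)_i) + |I| = Σ_i rank(Φ_i) + 1`, i.e.
`rank Hg(∏_j E_j × ∏_b A_b) = Σ rank Hg`. [cite: Gordon1999HodgeAVSurvey, §3 Theorem (1)] -/
theorem cmFamilyRank_add_card_eq_of_menu₃ (p : I → Prop) (Φ : ∀ i, CMType (K i))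
    (h2 : ∀ j, ¬p j → Module.finrank ℚ (K j) = 2)
    (hχ : ∀ i j, ¬p i → ¬p j → i ≠ j → ∃ g : ℂ ≃+* ℂ,
      ¬((∀ s : K i →+* ℂ, g • s = s) ↔ ∀ s : K j →+* ℂ, g • s = s))
    (hfor : ∀ a b, ¬p a → p b → IsEmpty (K a →+* K b))
    (hbb : ∀ a b, p a → p b → a ≠ b →
      ∃ σ : ℂ ≃+* ℂ, (∀ s : K a →+* ℂ, σ • s = conjugate s) ∧ ∀ s : K b →+* ℂ, σ • s = s) :
    CMAlgebra.cmFamilyRank Φ + Fintype.card I = (∑ i, cmTypeRank (Φ i)) + 1 :=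
  cmFamilyRank_add_card_eq_of_pairwise Φ (pairwise_of_menu₃ p Φ h2 hχ hfor hbb)

omit [∀ i, NumberField (K i)] [∀ i, IsCMField (K i)] [Fintype I] [DecidableEq I] [Nonempty I] in
/-- A sub-family of a separating family is separating (Kubota separation restricts to subsets of slots).
[cite: Kubota1965, §2 (p. 115)] -/
theorem isSeparatingFamily_subtype {Φ : ∀ i, CMType (K i)} (hsep : CMAlgebra.IsSeparatingFamily Φ) (q : I → Prop) :
    CMAlgebra.IsSeparatingFamily (fun j : {j // q j} => Φ j.1) := by
  intro x y h
  obtain ⟨h1, h2⟩ := Sigma.mk.inj_iff.1 (hsep ⟨x.1.1, x.2⟩ ⟨y.1.1, y.2⟩ h)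
  exact Sigma.ext (Subtype.ext h1) h2

/-- **The exact criterion: a shared imaginary quadratic field is the only obstruction.**  For a family with imaginary
quadratic slots off `B`, pairwise distinguished, and pairwise partial conjugations inside `B`:
`(Φ_i)_i` is nondegenerate iff every `Φ_b` (`b ∈ B`) is nondegenerate AND no quadratic field `K_a` embeds in a `K_b`
(⟸: the third menu; ⟹: members of nondegenerate families are nondegenerate, and a quadratic field shared by two slots
makes every family degenerate — seat b23's `not_isNondegenerateFamily_of_shared_imaginary_quadratic`).  In Moonen–Zarhin's
words for `X₁ × X₂`: exceptional classes iff `k ↪ End⁰(X₂)`. [cite: MoonenZarhin1999LowDim, Thm. (0.2) (a) and (4)]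
[cite: Gordon1999HodgeAVSurvey, 7.5–7.7] -/
theorem isNondegenerateFamily_iff_forall_isEmpty (p : I → Prop) (Φ : ∀ i, CMType (K i))
    (h2 : ∀ j, ¬p j → Module.finrank ℚ (K j) = 2)
    (hχ : ∀ i j, ¬p i → ¬p j → i ≠ j → ∃ g : ℂ ≃+* ℂ,
      ¬((∀ s : K i →+* ℂ, g • s = s) ↔ ∀ s : K j →+* ℂ, g • s = s))
    (hbb : ∀ a b, p a → p b → a ≠ b →
      ∃ σ : ℂ ≃+* ℂ, (∀ s : K a →+* ℂ, σ • s = conjugate s) ∧ ∀ s : K b →+* ℂ, σ • s = s) :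
    CMAlgebra.IsNondegenerateFamily Φ ↔
      (∀ b, p b → IsNondegenerate (Φ b)) ∧ ∀ a b, ¬p a → p b → IsEmpty (K a →+* K b) := by
  refine ⟨fun H => ⟨fun b _ => H.isNondegenerate b, fun a b ha hb => ⟨fun j => ?_⟩⟩,
    fun H => (isNondegenerateFamily_iff_of_menu₃ p Φ h2 hχ H.2 hbb).2 H.1⟩
  have hab : a ≠ b := fun h => ha (h ▸ hb)
  exact not_isNondegenerateFamily_of_shared_imaginary_quadratic (k := K a) (h2 a ha) hab (RingHom.id (K a)) j Φ H

/-- **Two kinds only — curves and ONE more CM field.**  For a family all of whose slots but `b` are imaginary quadratic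
and pairwise distinguished: nondegenerate iff `Φ_b` is nondegenerate and no `K_a` (`a ≠ b`) embeds in `K_b`.
[cite: MoonenZarhin1999LowDim, Thm. (0.2) (a) and (4)] -/
theorem isNondegenerateFamily_iff_forall_isEmpty_single (b : I) (Φ : ∀ i, CMType (K i))
    (h2 : ∀ j, j ≠ b → Module.finrank ℚ (K j) = 2)
    (hχ : ∀ i j, i ≠ b → j ≠ b → i ≠ j → ∃ g : ℂ ≃+* ℂ,
      ¬((∀ s : K i →+* ℂ, g • s = s) ↔ ∀ s : K j →+* ℂ, g • s = s)) :
    CMAlgebra.IsNondegenerateFamily Φ ↔ IsNondegenerate (Φ b) ∧ ∀ a, a ≠ b → IsEmpty (K a →+* K b) := by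
  rw [isNondegenerateFamily_iff_forall_isEmpty (fun i => i = b) Φ (fun j hj => h2 j hj)
    (fun i j hi hj hij => hχ i j hi hj hij) (fun a c ha hc hac => (hac (ha.trans hc.symm)).elim)]
  refine ⟨fun H => ⟨H.1 b rfl, fun a ha => H.2 a b ha rfl⟩, fun H => ⟨?_, ?_⟩⟩
  · rintro c rfl; exact H.1
  · rintro a c ha rfl; exact H.2 a ha

end Fields

/-! ## §2 Geometry: curves with foreign fields times CM abelian varieties -/

section Geometry

variable {I : Type} {K : I → Type} [∀ i, Field (K i)] [∀ i, NumberField (K i)] [∀ i, IsCMField (K i)] [Fintype I]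
  [DecidableEq I] [Nonempty I] {Φ : ∀ i, CMType (K i)}
variable {A : I → AbelianVariety ℂ} {ι : ∀ i, 𝓞 (K i) →+* End (A i)}
  {θ : ∀ i, K i →+* Module.End ℂ (complexBetti (A i).X 1)}

/-- **The Hodge conjecture from the third menu**: every `⨁_{k<N} A_{π k}` for a family with a separating imaginary
quadratic sub-family off `B`, every quadratic field foreign to every `K_b`, pairwise partial conjugations inside `B`, and
nondegenerate types on `B` — unconditionally. [cite: MoonenZarhin1999LowDim, Thm. (0.2) (4)]
[cite: Gordon1999HodgeAVSurvey, §3 Theorem and 10.10] -/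
theorem hodgeConjectureFor_prod_of_menu₃ (p : I → Prop) (h2 : ∀ j, ¬p j → Module.finrank ℚ (K j) = 2)
    (hsep : CMAlgebra.IsSeparatingFamily (fun j : {j // ¬p j} => Φ j.1))
    (hfor : ∀ a b, ¬p a → p b → IsEmpty (K a →+* K b))
    (hbb : ∀ a b, p a → p b → a ≠ b →
      ∃ σ : ℂ ≃+* ℂ, (∀ s : K a →+* ℂ, σ • s = conjugate s) ∧ ∀ s : K b →+* ℂ, σ • s = s)
    (hΦ : ∀ b, p b → IsNondegenerate (Φ b)) (hA : ∀ i, IsCMTypeRealisation (Φ i) (A i) (ι i) (θ i)) {N : ℕ}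
    (π : Fin N → I) : HodgeConjectureFor (⨁ fun j : Fin N => A (π j)).dim (⨁ fun j : Fin N => A (π j)).X :=
  ((isNondegenerateFamily_iff_of_menu₃ p Φ h2 (exists_not_iff_of_isSeparatingFamily p Φ h2 hsep) hfor hbb).2
    hΦ).hodgeConjectureFor_prod hA π

/-- **`Bᵐ ⊗ ℂ = Dᵐ ⊗ ℂ` from the third menu** (no exotic Hodge class on any `⨁_{k<N} A_{π k}`).
[cite: MoonenZarhin1999LowDim, Thm. (0.2) (4)] [cite: Gordon1999HodgeAVSurvey, §3 Theorem (2) and 7.5] -/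
theorem hodgeClassSpan_prod_eq_divisorClassesSpan_of_menu₃ (p : I → Prop)
    (h2 : ∀ j, ¬p j → Module.finrank ℚ (K j) = 2) (hsep : CMAlgebra.IsSeparatingFamily (fun j : {j // ¬p j} => Φ j.1))
    (hfor : ∀ a b, ¬p a → p b → IsEmpty (K a →+* K b))
    (hbb : ∀ a b, p a → p b → a ≠ b →
      ∃ σ : ℂ ≃+* ℂ, (∀ s : K a →+* ℂ, σ • s = conjugate s) ∧ ∀ s : K b →+* ℂ, σ • s = s)
    (hΦ : ∀ b, p b → IsNondegenerate (Φ b)) (hA : ∀ i, IsCMTypeRealisation (Φ i) (A i) (ι i) (θ i)) {N : ℕ}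
    (π : Fin N → I) (m : ℕ) :
    hodgeClassSpan (⨁ fun j : Fin N => A (π j)).dim (⨁ fun j : Fin N => A (π j)).X m =
      divisorClassesSpan (⨁ fun j : Fin N => A (π j)).X (⨁ fun j : Fin N => A (π j)).dim m :=
  ((isNondegenerateFamily_iff_of_menu₃ p Φ h2 (exists_not_iff_of_isSeparatingFamily p Φ h2 hsep) hfor hbb).2
    hΦ).hodgeClassSpan_prod_eq_divisorClassesSpan hA π m

/-- **`B• = D•` on ALL products iff the big types are nondegenerate and no curve field embeds in a `K_b`** — for a
SEPARATING family of realisations (simple, pairwise non-isogenous factors) with imaginary quadratic slots off `B` and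
pairwise partial conjugations inside `B`: the divisor regime ends exactly where an imaginary quadratic field is shared
(Moonen–Zarhin (0.2): (4) versus (a); Hazama–Murty 7.5 for the passage to Hodge classes).
[cite: MoonenZarhin1999LowDim, Thm. (0.2) (a) and (4)] [cite: Gordon1999HodgeAVSurvey, 7.5] -/
theorem forall_prod_hodgeClassSpan_eq_iff_forall_isEmpty (p : I → Prop)
    (h2 : ∀ j, ¬p j → Module.finrank ℚ (K j) = 2) (hsep : CMAlgebra.IsSeparatingFamily Φ)
    (hbb : ∀ a b, p a → p b → a ≠ b →
      ∃ σ : ℂ ≃+* ℂ, (∀ s : K a →+* ℂ, σ • s = conjugate s) ∧ ∀ s : K b →+* ℂ, σ • s = s)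
    (hA : ∀ i, IsCMTypeRealisation (Φ i) (A i) (ι i) (θ i)) :
    (∀ (N : ℕ) (π : Fin N → I) (m : ℕ),
      hodgeClassSpan (⨁ fun j : Fin N => A (π j)).dim (⨁ fun j : Fin N => A (π j)).X m =
        divisorClassesSpan (⨁ fun j : Fin N => A (π j)).X (⨁ fun j : Fin N => A (π j)).dim m) ↔
      (∀ b, p b → IsNondegenerate (Φ b)) ∧ ∀ a b, ¬p a → p b → IsEmpty (K a →+* K b) := by
  rw [← CMAlgebra.isNondegenerateFamily_iff_forall_prod_hodgeClassSpan_eq hsep hA]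
  exact isNondegenerateFamily_iff_forall_isEmpty p Φ h2
    (exists_not_iff_of_isSeparatingFamily p Φ h2 (isSeparatingFamily_subtype hsep _)) hbb

/-- **The Hodge conjecture for every `E_1^{a_1} × ⋯ × E_r^{a_r} × A_1^{c_1} × ⋯ × A_m^{c_m}` with FOREIGN curve fields**:
`E_j` realisations over imaginary quadratic fields forming a separating sub-family (pairwise non-isogenous CM elliptic
curves) whose fields embed in NO `K_b`; `A_b` (`b ∈ B`) realisations of NONDEGENERATE types of CM fields `K_b` such that
complex conjugation fixes `L_b ∩ L_{b'}` pointwise for `b ≠ b'` in `B` — unconditionally, no named fact.  Nothing is asked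
between a curve and `L_b`: `k_j ⊂ L_b ∖ K_b` is allowed. [cite: MoonenZarhin1999LowDim, Thm. (0.2) (4)]
[cite: Gordon1999HodgeAVSurvey, §3 Theorem and 10.10] -/
theorem hodgeConjectureFor_prod_curves_of_isEmpty (p : I → Prop)
    (h2 : ∀ j, ¬p j → Module.finrank ℚ (K j) = 2) (hsep : CMAlgebra.IsSeparatingFamily (fun j : {j // ¬p j} => Φ j.1))
    (hfor : ∀ a b, ¬p a → p b → IsEmpty (K a →+* K b))
    (hreal : ∀ b b', p b → p b' → b ≠ b' → ∀ x : ℂ, x ∈ normalClosure ℚ (K b) ℂ →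
      x ∈ normalClosure ℚ (K b') ℂ → starRingEnd ℂ x = x)
    (hΦ : ∀ b, p b → IsNondegenerate (Φ b)) (hA : ∀ i, IsCMTypeRealisation (Φ i) (A i) (ι i) (θ i)) {N : ℕ}
    (π : Fin N → I) : HodgeConjectureFor (⨁ fun j : Fin N => A (π j)).dim (⨁ fun j : Fin N => A (π j)).X :=
  hodgeConjectureFor_prod_of_menu₃ p h2 hsep hfor
    (fun b b' hb hb' hbb' => exists_pairConj_of_conj_apply_eq hbb' (hreal b b' hb hb' hbb')) hΦ hA π

/-- **The Hodge conjecture for every product of pairwise NON-ISOGENOUS CM elliptic curves with foreign fields and SIMPLE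
CM abelian varieties of dimension `≤ 3`** whose Galois closures pairwise meet in totally real fields (`A_b` simple:
primitive type, nondegenerate by Ribet's bound in degree `≤ 6`; Yanai in prime dimension) — e.g. ONE simple CM threefold
`T` with an ARBITRARY sextic CM field `K` (Galois or not) and curves `E_j` with CM by imaginary quadratic fields
`k_j ↪̸ K`: every `E_1^{a_1} × ⋯ × E_r^{a_r} × T^c` satisfies the Hodge conjecture — Moonen–Zarhin (0.2) (4) for
`X₁ × X₂` in the CM case, with multiplicities and several curves. [cite: MoonenZarhin1999LowDim, Thm. (0.2) (4) and Cor. (3.9)]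
[cite: Ribet1980, §3 Examples (3.7) (p. 87)] [cite: Shimura1998, §8.2 Prop. 26] -/
theorem hodgeConjectureFor_prod_curves_simple_of_isEmpty (p : I → Prop)
    (h2 : ∀ j, ¬p j → Module.finrank ℚ (K j) = 2)
    (hni : ∀ i j, ¬p i → ¬p j → i ≠ j → ¬AbelianVariety.IsIsogenous (A i) (A j))
    (hfor : ∀ a b, ¬p a → p b → IsEmpty (K a →+* K b))
    (hreal : ∀ b b', p b → p b' → b ≠ b' → ∀ x : ℂ, x ∈ normalClosure ℚ (K b) ℂ →
      x ∈ normalClosure ℚ (K b') ℂ → starRingEnd ℂ x = x)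
    (hA : ∀ i, IsCMTypeRealisation (Φ i) (A i) (ι i) (θ i)) (hS : ∀ b, p b → (A b).IsSimple)
    (h3 : ∀ b, p b → (A b).dim ≤ 3) {N : ℕ} (π : Fin N → I) :
    HodgeConjectureFor (⨁ fun j : Fin N => A (π j)).dim (⨁ fun j : Fin N => A (π j)).X :=
  hodgeConjectureFor_prod_curves_of_isEmpty p h2
    ((isSeparatingFamily_iff_pairwise_not_isIsogenous (Φ := fun j : {j // ¬p j} => Φ j.1) (fun j => h2 j.1 j.2)
        fun j => hA j.1).2 fun i j hij => hni i.1 j.1 i.2 j.2 fun h => hij (Subtype.ext h))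
    hfor hreal
    (fun b hb => isNondegenerate_of_isPrimitive_of_finrank_le_six (Φ b)
      (by rw [finrank_eq_two_mul_dim_of_isCMTypeRealisation (hA b)]; have := h3 b hb; omega)
      (Classical.arbitrary (K b →+* ℂ)) ((isSimple_iff_isPrimitive (hA b) _).1 (hS b hb))) hA π

end Geometry

end Summit.HodgeConjecture.CorCM

end
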